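import Mathlib
import HarnessLib
import Summits.NavierStokesRegularity.NavierStokesRegularity.Theses.LocalTubeStrainDoor
import Summits.NavierStokesRegularity.NavierStokesRegularity.Theorems.PlaneStrainDoorTargets

/-!
# Route `LocalTubeStrainDoor` (nsreg-p1 ROUND-15 door S16γ «tube strain») — birth closer: zoom crux `LocalPointZoomTubeStrain` (K1)

Moot-by-proof closer (nsreg-p6 g8 S16-family birth kit, DIRECTOR-NS g7 #22): the item text is closed BY NAME against the
landed theorems of `Theorems/PlaneStrainDoor*` (index HOME/ns-regularity-ideate-p6/KIT-INDEX-g8.md §C); statements are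
nsreg-p1's r15/Sketch16 / `route-s16-family/bc/FamilyItems.lean` texts.  WHAT THIS IS NOT: not NS regularity — a
CONDITIONAL one-window door under LOCAL SPACE–TIME Type I.
-/

noncomputable section

-- the summit and its single sub-problem share the name (CONVENTIONS §1)
set_option linter.dupNamespace false

open MeasureTheory Set Function Filter Topology Metric
open scoped RealInnerProductSpace InnerProductSpace NNReal ENNReal
open Literature.Analysis Literature.Analysis.FluidPDE
open Summit.NavierStokesRegularity.NavierStokesRegularity.Theorems.LocalSineTubeDoorLocalPointZoomGradSlices
open Summit.NavierStokesRegularity.NavierStokesRegularity.Theorems.LocalSineTubeDoorWindowFatou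
open Summit.NavierStokesRegularity.NavierStokesRegularity.Theorems.PlaneStrainDoorZoomSpaceTimeDecay
open Summit.NavierStokesRegularity.NavierStokesRegularity.Theorems.PlaneStrainDoorProfileWindowToSlab
open Summit.NavierStokesRegularity.NavierStokesRegularity.Theorems.PlaneStrainDoorProfileLiouvilles
open Summit.NavierStokesRegularity.NavierStokesRegularity.Theorems.PlaneStrainDoorTargets

namespace Summit.NavierStokesRegularity.NavierStokesRegularity.Theorems.LocalTubeStrainDoorK1Close

/-- **`LocalPointZoomTubeStrain` holds** (nsreg-p1's kit `k1_holds`: the tree's parabolic point zoom `localPointZoomVelGradSlices`,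
space–time decay of the profile `hasTypeIDecay_of_zoom`, and the window Fatou / strain-limit step). -/
theorem k1_proof : Summit.NavierStokesRegularity.NavierStokesRegularity.Theses.LocalTubeStrainDoor.LocalPointZoomTubeStrain := by
  intro ν T hν hT u p hcl hLH hdec x₀ ρ M hρ hM hann hnot
  obtain ⟨C, v, lam, hlam, hlam0, ⟨hrate, hcont, hmild, hdiv⟩, hsing, hconv⟩ :=
    localPointZoomVelGradSlices ν T hν hT u p hcl hLH hdec x₀ ρ M hρ (timeTypeI_of_spaceTimeTypeI hM) hnot
  have hdecay : HasTypeIDecay (M / ν) v :=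
    hasTypeIDecay_of_zoom hν hT hρ hlam hlam0 hM fun s hs y => (hconv s hs y).1
  refine ⟨C, M / ν, v, hrate, hdecay, hcont, hmild, hdiv, hsing, fun s hs y hy => ?_⟩
  have hns : 0 < -s := neg_pos.2 hs
  have hTt : ∀ j : ℕ, T - (T + lam j ^ 2 * s / ν) = lam j ^ 2 * ((-s) / ν) := fun j => by ring
  have htlt : ∀ j : ℕ, T + lam j ^ 2 * s / ν < T := fun j => by
    have : 0 < lam j ^ 2 * ((-s) / ν) := mul_pos (pow_pos (hlam j) 2) (div_pos hns hν)
    linarith [hTt j]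
  have htT : Tendsto (fun j : ℕ => T + lam j ^ 2 * s / ν) atTop (𝓝 T) := by
    have h1 : Tendsto (fun j => T + lam j ^ 2 * s / ν) atTop (𝓝 (T + 0 ^ 2 * s / ν)) :=
      tendsto_const_nhds.add (((hlam0.pow 2).mul_const s).div_const ν)
    simpa using h1
  have htT' : Tendsto (fun j : ℕ => T + lam j ^ 2 * s / ν) atTop (nhdsWithin T (Set.Iio T)) :=
    tendsto_nhdsWithin_iff.2 ⟨htT, Eventually.of_forall fun j => htlt j⟩
  have hsq : 0 < Real.sqrt ((-s) / ν) := Real.sqrt_pos.2 (div_pos hns hν)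
  have hS0 : Real.sqrt ((-s) / ν) ≠ 0 := hsq.ne'
  have hy' : 0 < ‖y‖ := norm_pos_iff.2 hy
  set κ : ℝ := ‖y‖ / Real.sqrt ((-s) / ν) with hκ
  have hκpos : 0 < κ := div_pos hy' hsq
  have hyκ : ‖y‖ = κ * Real.sqrt ((-s) / ν) := by rw [hκ, div_mul_cancel₀ _ hS0]
  have hsqrtT : ∀ j : ℕ, Real.sqrt (T - (T + lam j ^ 2 * s / ν)) = lam j * Real.sqrt ((-s) / ν) :=
    fun j => by rw [hTt j, Real.sqrt_mul (pow_nonneg (hlam j).le 2), Real.sqrt_sq (hlam j).le]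
  have hdist : ∀ j : ℕ, ‖x₀ + lam j • y - x₀‖ = lam j * ‖y‖ := fun j => by
    rw [add_sub_cancel_left, norm_smul, Real.norm_eq_abs, abs_of_pos (hlam j)]
  have hev : ∀ η : ℝ, 0 < η → ∀ᶠ j : ℕ in atTop, strainEigenvalues
      (((lam j ^ 2 / ν) • fderiv ℝ (u (T + lam j ^ 2 * s / ν)) (x₀ + lam j • y) :
        EuclideanSpace ℝ (Fin 3) →L[ℝ] EuclideanSpace ℝ (Fin 3)) :
        EuclideanSpace ℝ (Fin 3) →ₗ[ℝ] EuclideanSpace ℝ (Fin 3)) finrank_euclideanSpace_fin 1 ≤ η / (-s) := by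
    intro η hη
    have h := htT'.eventually (hann (κ / 2) (2 * κ) η (half_pos hκpos) (by linarith) hη)
    filter_upwards [h] with j hj
    have hpos : 0 < lam j * (κ * Real.sqrt ((-s) / ν)) := mul_pos (hlam j) (mul_pos hκpos hsq)
    have h1 : κ / 2 * Real.sqrt (T - (T + lam j ^ 2 * s / ν)) ≤ ‖x₀ + lam j • y - x₀‖ := by
      rw [hsqrtT, hdist, hyκ]; nlinarith [hpos]
    have h2 : ‖x₀ + lam j • y - x₀‖ ≤ 2 * κ * Real.sqrt (T - (T + lam j ^ 2 * s / ν)) := by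
      rw [hsqrtT, hdist, hyκ]; nlinarith [hpos]
    have hmaj := midStrain_le_of_twoFrame (hj (x₀ + lam j • y) h1 h2)
    have hc : 0 ≤ lam j ^ 2 / ν := (div_pos (pow_pos (hlam j) 2) hν).le
    have hscale := midStrain_smul_le hc hmaj
    have hl0 : lam j ≠ 0 := (hlam j).ne'
    have hν0 : ν ≠ 0 := hν.ne'
    have hs0 : -s ≠ 0 := hns.ne'
    have heq : lam j ^ 2 / ν * (η / (T - (T + lam j ^ 2 * s / ν))) = η / (-s) := by
      rw [hTt j]; field_simp
    rwa [heq] at hscale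
  have hlim : ∀ η : ℝ, 0 < η → strainEigenvalues (fderiv ℝ (v s) y :
      EuclideanSpace ℝ (Fin 3) →ₗ[ℝ] EuclideanSpace ℝ (Fin 3)) finrank_euclideanSpace_fin 1 ≤ η / (-s) := fun η hη =>
    midStrain_le_of_tendsto (hconv s hs y).2 (hev η hη)
  exact twoFrame_of_midStrain_le (midStrain_nonpos_of_forall hns hlim)

end Summit.NavierStokesRegularity.NavierStokesRegularity.Theorems.LocalTubeStrainDoorK1Close

end
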